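import Mathlib
import HarnessLib
import HarnessLib.Audit
import Summits.Langlands.Statement
import Literature.NumberTheory.Automorphic.CompletedCohomology
import HarnessLib.Audit.Status.Attr

/-!
Route: BianchiDeligneSerre

DORMANT since 2026-08-23T21:10:47Z (reconciler: no traction for 6.2 d (last activity item-evidence-added at 2026-08-17T14:38:37Z); parked, not closed — `ledger route dormant route-Langlands-BianchiDeligneSerre --off` to reactivate) — unstaffed, not closed; items shared with open routes are served there. `ledger route dormant <id> --off` reactivates.

# Route BianchiDeligneSerre — Deligne–Serre at the parity-free field — Artin-type Bianchi forms get
their Galois representations from torsion shadows and Rankin–Selberg on average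

TRANSFER LENS (sibling = Deligne–Serre 1974, the proved irregular low-rank case of this summit:
weight-one forms ↦ Artin representations). It suffices to show X = C1 ∧ C2 for every cuspidal
automorphic π of GL₂(𝔸_K), K imaginary quadratic, of ARTIN TYPE (infinity type with all exponents
(0,0): the λ = 1 Maass forms on ℍ³; this sector of direction (A), n = 2, contains the base change of
every even Maass form of eigenvalue 1/4 over ℚ and every genuinely-K "weight one" system): C1
(PadicAutomorphyArtinTypeK) — for infinitely many primes p (and every ι : ℚ̄_p ≃ ℂ) the Hecke
eigensystem of π is a ℤ̄_p-point of the big Hecke algebra 𝕋(U^p) of Emerton's completed cohomology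
of the Bianchi tower (t_(v,1) ↦ ι⁻¹(α+β), q_v t_(v,2) ↦ ι⁻¹(αβ)); C2 (ArithmeticityArtinTypeK) — the
Satake traces and determinants of π are integers of ONE number field E and every ℚ-embedding of E
carries them to the eigensystem of another Artin-type cuspidal π′ (Buzzard–Gee L-arithmeticity +
Clozel's conjugates, for this sector). Then Deligne–Serre's §§5–8, with Scholze's torsion
determinants in place of Deligne's weight-ℓ representations and Jacquet–Shalika in place of Rankin,
output an irreducible ρ_π with FINITE image matching π at almost every place, for every ℓ and ι
(support DeligneSerreTransportK); the junction ArtinTypeSectorToLanglands is the honestly-labelled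
rest of the summit. No card is realised (novel-route seat, lens transfer).
Lean: `PadicAutomorphyArtinTypeK ∧ ArithmeticityArtinTypeK`

## Assembly
Pure logic (sorry-free in Sketch.lean, rc 0): for each K, hcpt, π of Artin type, feed C2's
arithmeticity data and C1's Hecke points into DeligneSerreTransportK to get the finite-image ρ for
every ℓ, ι; the junction takes the sector statement to `Langlands`. The deciding theorem `closes` is
`h₄ (fun K _ _ hK hK2 hcpt π hπ => h₃ K hK hK2 hcpt π hπ (h₂ …) (h₁ …))`.

Rationale: WHY THIS LINE. Deligne–Serre prove (A) at the singular weight by (2.7) an integral structure with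
Galois-conjugate eigensystems again automorphic, (5.1/5.5) Rankin's mean-square bound, (6.7)
congruences f ≡ f·E_(ℓ−1) moving the weight-one eigensystem mod λ into weight ℓ where Deligne's
representations live, (7.2, 8.3–8.4) boundedness of the images G_λ ⊂ GL₂(𝔽_λ) for infinitely many λ,
then lifting and Chebotarev [DeligneSerre1974]. Transported to Artin-type π over a number field: 5.x
becomes Jacquet–Shalika (L(s, π × π̃) has a simple pole, [JacquetShalika1981]) and 7.2/§8 are
field-agnostic; 2.7 breaks (no algebraic variety carries these forms) and 6.7 breaks (no sheaf ω, no
Hasse invariant). Over ℚ the transport is DEAD BY PARITY: every mod-ℓ eigensystem in the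
Betti/torsion cohomology of modular curves is odd for ℓ odd, so an even Maass system has no residual
shadow; over an imaginary quadratic K there is no complex conjugation, Scholze's determinants attach
Galois representations to EVERY mod-p^m Bianchi eigensystem [Scholze2015], and the Hasse congruence
is replaced by the tautology that a point of Spf 𝕋(U^p) has reductions mod p^m occurring at finite
level — so 6.7 becomes exactly C1 (p-adic occupancy of the Artin-type eigensystem, the
automorphic-side twin of the Galois-side occupancy cruxes of the door routes) and 2.7 becomes C2.
What the line does that no listed route does: it is an (A)-direction engine for Artin type that
needs neither Ramanujan/Kronecker (route RationalPeriodQuarter hands its algebraicity to card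
kronecker-rigidity-artin-type) nor R = 𝕋 / classicality at the singular weight
(RuelleTorsionArtinWeight, ParityBlindBianchi, EvenIcosahedralCMCorner, CMFern are all (B)-side and
carry a classicality crux), and it is blind to the image of ρ (icosahedral and solvable alike: no
base change along the splitting field). Imported areas: p-adic/torsion cohomology of arithmetic
3-manifolds (completed cohomology [CalegariEmerton2011], [HansenUniversalEigenvarieties2017]);
analytic number theory only through the mean square. Calegari–Mazur [CalegariMazur2008,
arXiv:0708.2451 Thm 8.1] show (under Leopoldt) that such points are isolated from classical Bianchi
families, which is why C1 must be won by a DIRECT construction of the completed-cohomology class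
(proposed engine, Not decomposed yet: the p–∞ switch of s = 1 boundary cocycles, whose factor
|cz+d|⁻² is a rational function of (z, z̄)) or through torsion, never by interpolation from
cohomological weight.

RANKED CRUXES. #2 PadicAutomorphyArtinTypeK (crux) — For K imaginary quadratic and π cuspidal
automorphic on GL₂(𝔸_K) of Artin type (an infinity type with all exponents a = b = 0), for every P₀
there is a prime p ≥ P₀ such that for every ι : ℚ̄_p ≃ ℂ the eigensystem of π is p-adically
automorphic of some tame level: there are a finite set S ⊇ (places above p), a tame level U
hyperspecial outside S, uniformisers, and ℤ̄_p-valued eigenvalues a_(v,i) forming a point of Spf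
𝕋(U^p) (tree `IsHeckePoint` over the p-power Bianchi tower, Hansen/Scholze operators t_(v,i)) with
ι(a_(v,1)) = α+β and q_v·ι(a_(v,2)) = αβ for the Satake parameter (α,β) of π at every v ∉ S (so that
an associated Galois representation has geometric-Frobenius polynomial (X−α)(X−β), Hansen Def.
1.2.1). This is DS Thm 6.7 transported: the completed-cohomology substitute for f ↦ f·E_(ℓ−1).
[difficulty: open-problem] (why it might fail: Fails only if Bianchi completed cohomology misses
Artin-type points (against Calegari–Geraghty/Hansen Conj. 1.2.3); CalegariMazur2008 Thm 8.1: no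
classical family reaches them, so interpolation proofs cannot work; as typed ∀ι forces BG
L-arithmeticity of π.) [DeligneSerre1974, CalegariMazur2008, arXiv:0708.2451, CalegariEmerton2011,
HansenUniversalEigenvarieties2017, GeeNewton2020, Scholze2015]
#3 ArithmeticityArtinTypeK (crux) — For K imaginary quadratic and π cuspidal of Artin type there are
a number field E ⊂ ℂ and functions s, d : places → E such that for almost all v the Satake parameter
(α,β) of π has α+β = s(v), αβ = d(v) with s(v), d(v) algebraic integers (Buzzard–Gee Conj. 3.1.5,
L-arithmeticity, with integrality), and for every ℚ-embedding τ : E → ℂ there is a cuspidal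
Artin-type π′ on GL₂(𝔸_K) with Satake sums/products τ(s(v)), τ(d(v)) almost everywhere (Clozel's
Aut(ℂ)-stability for this sector). This is DS 2.7 transported (there: q-expansion principle over ℤ
via the Tate curve); Deligne–Serre's Prop. 5.5 uses exactly these two clauses. [difficulty:
open-problem] (why it might fail: False only if some λ=1 Bianchi–Maass eigensystem is transcendental
or has a non-automorphic conjugate (against BG Conj. 3.1.5/Clozel); unprovable-looking without an
algebraic realisation — no variety, no q-expansion principle, rational cocycles untested over K.)
[BuzzardGeeLMS2014, Clozel1990, DeligneSerre1974, Scholze2015, zbl:1035.11023,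
doi:10.1090/memo/1118]
#9 DeligneSerreTransportK (support) — THE TRANSPORTED ENGINE (theorem schema, provable from named
facts): for K imaginary quadratic and π cuspidal of Artin type, C2's conclusion for π and C1's
conclusion for π imply that for every ℓ and ι there is an irreducible ρ : Γ_K → GL₂(ℚ̄_ℓ) with
finite image, Satake–Frobenius compatible with π at almost all v. Proof plan = DS §§5–8 verbatim
over K: (i) a point of Spf 𝕋(U^p) gives, by Scholze's determinant on the big Hecke algebra (I
nilpotent, killed by the ℤ̄_p-point) a semisimple ρ_p : Γ_K → GL₂(ℚ̄_p) unramified outside S with tr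
ρ_p(Frob_v) = ι⁻¹(α+β), and its residual semisimplification ρ̄_p (Scholze2015 Thm V.4.1/Cor. V.4.4);
(ii) Jacquet–Shalika: Σ_v |s(v)|² q_v^(−σ) ≤ log 1/(σ−1) + O(1) for π and for each conjugate π′ (DS
Prop. 5.1 ↦ the simple pole of L(s, π×π̃)); (iii) hence for every η a set of places of upper density
≤ η off which (s(v),d(v)) lies in a finite set (DS Prop. 5.5); (iv) DS Prop. 7.2 + Chebotarev over
K: |ρ̄_p(Γ_K)| ≤ A for the infinitely many p of C1 (DS Lemmas 8.3–8.4); (v) lift the prime-to-p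
images to characteristic 0, compare two large p by DS Lemma 3.2 to remove ramification at p,
conclude finite image, traces s(v), irreducibility from the simple pole (DS §8 end), and transport
the complex ρ to every ℚ̄_ℓ along ι. [difficulty: L] [DeligneSerre1974, Scholze2015,
JacquetShalika1981, CalegariEmerton2011]
#9 ArtinTypeSectorToLanglands (support) — JUNCTION — the honestly-labelled rest of the summit, filed
only so that the deciding theorem ends in the summit constant: (A) in the almost-everywhere Satake
form with finite image for Artin-type cuspidal π on GL₂ over imaginary quadratic fields ⇒
`Langlands`. It packages (i) the upgrade of a finite-image a.e.-compatible ρ to the summit's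
`Corresponds` (de Rham = finite image; local–global compatibility at the remaining places by
stability of γ-factors and the local converse theorem for GL₂, as in DS §4(b)), (ii) the descent K →
ℚ for base-changed even Maass forms (two auxiliary imaginary quadratic fields), and (iii) everything
else in the summit (other n, other fields, other infinity types, direction (B)). Nobody should
attempt it as a whole; it is bookkeeping. [difficulty: open-problem] [BuzzardGeeLMS2014,
DeligneSerre1974]

TWO-LAYER PLAN. Foreseen glued splits, none filed now: C1 ⇐ (BaseChangeOccupancy: BC(f)⊗χ and
dihedral systems are Hecke points, via f·E_(p−1)^(p^m), classical base change and Scholze's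
classical→completed comparison — provable now) → (GenuineOccupancy: the non-base-change,
non-dihedral systems) → C1. C2 ⇐ (RationalBoundaryClassesK: s = 1 boundary cocycles of λ = 1 forms
on Γ₁(𝔫) ≤ SL₂(𝒪_K) are cohomologous to cocycles valued in cusp-polar K-rational functions of (z,
z̄), weight (−1,−1) action) → (descending-chain lemma, as RationalEigencharacterLemma of route
RationalPeriodQuarter) → C2; the same rational classes pushed into locally analytic induction at
weight (1,1) are the proposed direct construction for C1 (p–∞ switch).

KILL CRITERIA. (1) A theorem that completed cohomology of Bianchi manifolds omits some Artin-type
cuspidal eigensystem for all but finitely many p (¬C1) closes the route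
refuted:PadicAutomorphyArtinTypeK — it would also falsify the Calegari–Geraghty "R = 𝕋" picture, so
it is informative either way. (2) ¬C2 contradicts Buzzard–Gee 3.1.5 + Langlands; a refutation means
a mistyped clause (restate once, then close). (3) If DeligneSerreTransportK is refuted as typed
(e.g. the conjugate clause of C2 is too weak to run DS Prop. 5.5, or the t_(v,2) normalisation is
off by q_v), that is a planner error: restate the support, the line survives. (4) Mooted if
LiftDescend/CMFern prove (A) over CM fields in all weights.

NOT DECOMPOSED YET. The ENGINE for C1/C2 (rational boundary classes at s = 1 for PSL₂(ℂ):
Bruggeman–Lewis–Zagier theory for Kleinian groups with cusps is not in print; Bunke–Olbrich treat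
cocompact Γ) is deliberately not an item: it needs Maass forms on ℍ³ and Γ-cohomology with an
infinite-dimensional module typed from scratch; it is filed informally after open. The
base-change/dihedral special case of C1 (provable now) is left to provers as a support lemma
(`--supports`). The descent K → ℚ for even Maass forms and the LGC upgrade live in the junction.
Level optimisation (S = ramified places ∪ (v ∣ p)) and the choice "p split in K" are left free (∃ p
≥ P₀).

CHEAPEST FALSIFIER. Run C1 on the KNOWN case π = BC(f), f a classical weight-one newform (e.g. level
23) and K = ℚ(i): the congruences f ≡ f·E_(p−1)^(p^m) mod p^(m+1), classical quadratic base change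
of the weight-(1+(p−1)p^m) eigenforms and Scholze's comparison must produce the typed `IsHeckePoint`
with ι(a_(v,1)) = α+β, q_v ι(a_(v,2)) = αβ; if the normalisation cannot be matched even there, the
typing (not the line) is wrong — restate. Lookup falsifier already run: Calegari–Mazur
arXiv:0708.2451 §8.2 (read) does NOT exclude the points, only classical families through them (Thm
8.1, under Leopoldt). No kit job: nothing here is finite.

DEFINITION REQUESTS. None needed for the typed items (all constants exist: `IsHeckePoint`,
`LevelTower.ofSeq`, `heckeDiagAt`, `GLn.sndHom`, `HasSatakeParamAt`, `HasInfinityType`,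
`FramedGaloisRep`, `SatakeFrobCompatibleAt`). For the engine (later): `BianchiMaassForm` (C²
eigenfunctions of the Laplacian on ℍ³ for congruence subgroups of SL₂(𝒪_K)) and
`CuspPolarRationalModule` — to be requested with the informal crux, topic
Summits/Langlands/Langlands/Theorems.

Novelty: Searches (2026-08-16): ledger negatives --problem Langlands (1, unrelated); all 37 open route
headers + 130 cards grepped for Deligne–Serre / torsion-(A) / Hecke points of π (hits:
carayol-domains-deligne-serre CLOSED known = Carayol 1998 DS model via U(2,1) Griffiths–Schmid
domains over ℚ; quarter-isolation CLOSED vacuous; tempered-edge p–∞ switch CLOSED superseded into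
rational-period-functions-quarter; kronecker-rigidity-artin-type open card = Ramanujan/Kronecker;
RuelleTorsionArtinWeight / ParityBlindBianchi = Galois-side occupancy); lit read
doi:10.24033/asens.1277 (DS 1974: Prop 5.1, 5.5, Thm 6.7, Prop 7.2, §8) and arXiv:0708.2451
(Calegari–Mazur §1, §8.2 Thm 8.1); lit search --source zbmath "even Galois representations imaginary
quadratic torsion cohomology" (2: Allen–Khare–Thorne arXiv:1910.12986, unrelated), "Maass forms
eigenvalue 1/4 Galois representations" (Sarnak zbl:1035.11023, Vignéras
doi:10.1017/s0017089500006200, Booker–Strömbergsson), "p-adic Maass forms eigenvariety" (0),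
"overconvergent Bianchi weight one" (0); --source arxiv "Artin representations completed cohomology
imaginary quadratic" (0), "Maass forms eigenvalue 1/4 p-adic overconvergent" (0); --source crossref
"Deligne-Serre lifting Bianchi modular forms weight one" (0 relevant); lit galaxy search
"Deligne-Serre" --star pdf (7 expository hits, Weinstein BAMS read); local hybrid index and
OpenAlex/S2 unavailable this session (daemon reset / budget), recorded in NOTES.
Nearest prior art found: Delign  [refs: 10.24033/asens.1277, 10.1017/s0017089500006200, 10.1023/a:1000282229017, 0708.2451, 1910.12986, doi:10.24033/asens.1277, doi:10.1017/s0017089500006200, doi:10.1023/a, DeligneSerre1974, Carayol1998, CalegariMazur2008]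

Barriers (technique_class: deligne-serre-finiteness, completed-cohomology): - technique_class: deligne-serre-finiteness, completed-cohomology
- Literature.Barriers.Langlands.NonRegularWeightBarrier: met head-on and evaded in its narrowed
form: no Betti cohomology with algebraic coefficients and no classicality statement at the wall is
used; completed cohomology enters only through OCCUPANCY of a point at weight (1,1), and the
Galois-theoretic conclusion is extracted by Deligne–Serre finiteness across infinitely many p from
the Rankin–Selberg mean square, not by identifying a p-adic form with a classical one.
- Literature.Barriers.Langlands.NonRegularWeightBarrierNarrow: the narrow record exempts "p-adic
interpolation, eigenvarieties, completed cohomology … whose weight space contains the walls"; this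
line lives exactly in that exemption (occupancy at the wall, no algebraic local system V_λ).
- Literature.Barriers.Langlands.ShimuraVarietyRealizationBarrier: not engaged — K is CM (imaginary
quadratic), Scholze's torsion classes and determinants exist; nothing is realised in étale
cohomology of a Shimura variety.
- Literature.Barriers.Langlands.ShimuraVarietyRealizationBarrierNarrow: its completed-cohomology
token concerns realising π for non-CM/TR fields; here d = [K:K⁺] = 2 and the torsion/completed
cohomology of GL₂/K is Scholze's own setting — not engaged.
- Literature.Barriers.Langlands.ModPLanglandsGL2BeyondQpFpBar: not engaged — no p-adic or mod-p
local Langlands, no Breuil–Mézard, no Colmez functor; completed cohomology is used only as the Hecke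

History (route lifecycle, newest last):
- 2026-08-23T21:10:47Z · DORMANT — reconciler: no traction for 6.2 d (last activity item-evidence-added at 2026-08-17T14:38:37Z); parked, not closed — `ledger route dormant route-Langlands-Bianch (operator:999:2837940)

sub-problem: Langlands · status: dormant · opened planner-plan-lens-Langlands-transfer-v2-0 2026-08-16T16:02:49Z · rev 4 · ledger route-Langlands-BianchiDeligneSerre
GENERATED by the gate from the ledger (D-0016/17). Provers cite these decls: `theorem foo : Summit.Langlands.Langlands.Theses.BianchiDeligneSerre.<Decl> := …` in Summits/Langlands/Langlands/Theorems/<Name>.lean.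
-/

namespace Summit.Langlands.Langlands.Theses.BianchiDeligneSerre

open scoped BigOperators Topology Manifold Classical MeasureTheory ProbabilityTheory Matrix InnerProductSpace ComplexConjugate ContinuousMap
open Filter Set Function TopologicalSpace MeasureTheory

attribute [summit_statement] _root_.Langlands

/-- item stmt-Langlands-15868 · crux · rank 2 · open · by planner
why it might fail: Fails only if Bianchi completed cohomology misses Artin-type points (against Calegari–Geraghty/Hansen Conj. 1.2.3); CalegariMazur2008 Thm 8.1: no classical family reaches them, so interpolation proofs cannot work; as typed ∀ι forces BG L-arithmeticity of π.
sources: DeligneSerre1974, CalegariMazur2008, arXiv:0708.2451, CalegariEmerton2011, HansenUniversalEigenvarieties2017, GeeNewton2020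
[crux] For K imaginary quadratic and π cuspidal automorphic on GL₂(𝔸_K) of Artin type (an infinity
type with all exponents a = b = 0), for every P₀ there is a prime p ≥ P₀ such that for every ι :
ℚ̄_p ≃ ℂ the eigensystem of π is p-adically automorphic of some tame level: there are a finite set S
⊇ (places above p), a tame level U hyperspecial outside S, uniformisers, and ℤ̄_p-valued eigenvalues
a_(v,i) forming a point of Spf 𝕋(U^p) (tree `IsHeckePoint` over the p-power Bianchi tower,
Hansen/Scholze operators t_(v,i)) with ι(a_(v,1)) = α+β and q_v·ι(a_(v,2)) = αβ for the Satake
parameter (α,β) of π at every v ∉ S (so that an associated Galois representation has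
geometric-Frobenius polynomial (X−α)(X−β), Hansen Def. 1.2.1). This is DS Thm 6.7 transported: the
completed-cohomology substitute for f ↦ f·E_(ℓ−1). [difficulty: open-problem] -/
@[route_item "route-Langlands-BianchiDeligneSerre", crux]
def PadicAutomorphyArtinTypeK : Prop :=
  ∀ (K : Type) [Field K] [NumberField K], NumberField.IsTotallyComplex K → Module.finrank ℚ K = 2 → ∀ (hcpt : Literature.NumberTheory.Automorphic.isCompact_glFiniteIntegralLevel 2 K) (π : Literature.NumberTheory.Automorphic.CuspidalAutomorphicRepData 2 K hcpt), (∃ T : Literature.NumberTheory.Automorphic.InfinityType K 2, π.1.HasInfinityType T ∧ ∀ σ : K →+* ℂ, ∀ w ∈ T σ, w.a = 0 ∧ w.b = 0) → ∀ P₀ : ℕ, ∃ (p : ℕ) (_ : Fact p.Prime), P₀ ≤ p ∧ ∀ ι : PadicAlgCl p ≃+* ℂ, ∃ (S : Finset (IsDedekindDomain.HeightOneSpectrum (NumberField.RingOfIntegers K))) (U : Subgroup (GL (Fin 2) (IsDedekindDomain.FiniteAdeleRing (NumberField.RingOfIntegers K) K))) (ϖ : ∀ v : IsDedekindDomain.HeightOneSpectrum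 (NumberField.RingOfIntegers K), (v.adicCompletion K)ˣ) (a : {v : IsDedekindDomain.HeightOneSpectrum (NumberField.RingOfIntegers K) // v ∉ S} → ℕ → (Valued.v (R := PadicAlgCl p)).valuationSubring), (∀ v : IsDedekindDomain.HeightOneSpectrum (NumberField.RingOfIntegers K), ((p : ℕ) : NumberField.RingOfIntegers K) ∈ v.asIdeal → v ∈ S) ∧ IsOpen (U : Set (GL (Fin 2) (IsDedekindDomain.FiniteAdeleRing (NumberField.RingOfIntegers K) K))) ∧ U ≤ Literature.NumberTheory.Automorphic.glFiniteIntegralLevel 2 K ∧ (∀ g ∈ Literature.NumberTheory.Automorphic.glFiniteIntegralLevel 2 K, (∀ v ∈ S, ∀ i j : Fin 2, ((g : Matrix (Fin 2) (Fin 2) (IsDedekindDomain.FiniteAdeleRing (NumberField.RingOfIntegers K) K)) i j) v = (1 : Matrix (Fin 2) (Fin 2) (v.adicCompletion K)) i j) → g ∈ U) ∧ (∀ v : IsDedekindDomain.HeightOneSpectrum (NumberField.RingOfIntegers K), Valued.v ((ϖ v : (v.adicCompletion K)ˣ) : v.adicCompletion K) = WithZero.exp (-1 : ℤ)) ∧ Literature.NumberTheory.Automorphic.IsHeckePoint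 (Matrix.GeneralLinearGroup.map (n := Fin 2) (algebraMap K (IsDedekindDomain.FiniteAdeleRing (NumberField.RingOfIntegers K) K))) (Literature.NumberTheory.Automorphic.LevelTower.ofSeq U (fun r : ℕ => (Literature.NumberTheory.Automorphic.principalCongruenceLevel 2 K (Ideal.span {((p : ℕ) : NumberField.RingOfIntegers K)} ^ r)).map (Literature.NumberTheory.Automorphic.GLn.sndHom 2 K))) ((p : ℕ) : (Valued.v (R := PadicAlgCl p)).valuationSubring) (fun j : {v : IsDedekindDomain.HeightOneSpectrum (NumberField.RingOfIntegers K) // v ∉ S} × Fin 2 => Literature.NumberTheory.Automorphic.GLn.sndHom 2 K (Literature.NumberTheory.Automorphic.heckeDiagAt 2 K j.1.1 (ϖ j.1.1) (j.2.val + 1))) (fun j => a j.1 (j.2.val + 1)) ∧ ∀ (v : IsDedekindDomain.HeightOneSpectrum (NumberField.RingOfIntegers K)) (hv : v ∉ S), ∃ α : Multiset ℂ, π.1.HasSatakeParamAt v α ∧ ι ((a ⟨v, hv⟩ 1 : (Valued.v (R := PadicAlgCl p)).valuationSubring) : PadicAlgCl p) = α.sum ∧ ((v.residueCard : ℕ)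 : ℂ) * ι ((a ⟨v, hv⟩ 2 : (Valued.v (R := PadicAlgCl p)).valuationSubring) : PadicAlgCl p) = α.prod

/-- item stmt-Langlands-15869 · crux · rank 3 · open · by planner
why it might fail: False only if some λ=1 Bianchi–Maass eigensystem is transcendental or has a non-automorphic conjugate (against BG Conj. 3.1.5/Clozel); unprovable-looking without an algebraic realisation — no variety, no q-expansion principle, rational cocycles untested over K.
sources: BuzzardGeeLMS2014, Clozel1990, DeligneSerre1974, Scholze2015, zbl:1035.11023, doi:10.1090/memo/1118
[crux] For K imaginary quadratic and π cuspidal of Artin type there are a number field E ⊂ ℂ and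
functions s, d : places → E such that for almost all v the Satake parameter (α,β) of π has α+β =
s(v), αβ = d(v) with s(v), d(v) algebraic integers (Buzzard–Gee Conj. 3.1.5, L-arithmeticity, with
integrality), and for every ℚ-embedding τ : E → ℂ there is a cuspidal Artin-type π′ on GL₂(𝔸_K) with
Satake sums/products τ(s(v)), τ(d(v)) almost everywhere (Clozel's Aut(ℂ)-stability for this sector).
This is DS 2.7 transported (there: q-expansion principle over ℤ via the Tate curve); Deligne–Serre's
Prop. 5.5 uses exactly these two clauses. [difficulty: open-problem] -/
@[route_item "route-Langlands-BianchiDeligneSerre", crux]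
def ArithmeticityArtinTypeK : Prop :=
  ∀ (K : Type) [Field K] [NumberField K], NumberField.IsTotallyComplex K → Module.finrank ℚ K = 2 → ∀ (hcpt : Literature.NumberTheory.Automorphic.isCompact_glFiniteIntegralLevel 2 K) (π : Literature.NumberTheory.Automorphic.CuspidalAutomorphicRepData 2 K hcpt), (∃ T : Literature.NumberTheory.Automorphic.InfinityType K 2, π.1.HasInfinityType T ∧ ∀ σ : K →+* ℂ, ∀ w ∈ T σ, w.a = 0 ∧ w.b = 0) → ∃ (E : IntermediateField ℚ ℂ) (s d : IsDedekindDomain.HeightOneSpectrum (NumberField.RingOfIntegers K) → E), FiniteDimensional ℚ E ∧ (∀ᶠ v : IsDedekindDomain.HeightOneSpectrum (NumberField.RingOfIntegers K) in Filter.cofinite, IsIntegral ℤ (s v) ∧ IsIntegral ℤ (d v) ∧ ∃ α : Multiset ℂ, π.1.HasSatakeParamAt v α ∧ ((s v : E) : ℂ) = α.sum ∧ ((d v : E) : ℂ) = α.prod) ∧ ∀ τ : E →ₐ[ℚ] ℂ, ∃ π' : Literature.NumberTheory.Automorphic.CuspidalAutomorphicRepData 2 K hcpt, (∃ T' : Literature.NumberTheory.Automorphic.InfinityType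 K 2, π'.1.HasInfinityType T' ∧ ∀ σ : K →+* ℂ, ∀ w ∈ T' σ, w.a = 0 ∧ w.b = 0) ∧ ∀ᶠ v : IsDedekindDomain.HeightOneSpectrum (NumberField.RingOfIntegers K) in Filter.cofinite, ∃ α' : Multiset ℂ, π'.1.HasSatakeParamAt v α' ∧ τ (s v) = α'.sum ∧ τ (d v) = α'.prod

/-- item stmt-Langlands-15870 · crux · rank 9 · open · by planner
why it might fail: Theorem-level (DS §§5–8 + Scholze V.4 + Jacquet–Shalika) but far from formal; false as typed if Scholze's big-Hecke-algebra determinant needs more than a uniformly nilpotent ideal killed by ℤ̄_p-points, if C2's conjugate clause is too weak for DS Prop 5.5, or if t_(v,2)=αβ/q_v is mis-normalised.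
sources: DeligneSerre1974, Scholze2015, JacquetShalika1981, CalegariEmerton2011, NewtonThorne2016
[support] THE TRANSPORTED ENGINE (theorem schema, provable from named facts): for K imaginary
quadratic and π cuspidal of Artin type, C2's conclusion for π and C1's conclusion for π imply that
for every ℓ and ι there is an irreducible ρ : Γ_K → GL₂(ℚ̄_ℓ) with finite image, Satake–Frobenius
compatible with π at almost all v. Proof plan = DS §§5–8 verbatim over K: (i) a point of Spf 𝕋(U^p)
gives, by Scholze's determinant on the big Hecke algebra (I nilpotent, killed by the ℤ̄_p-point) a
semisimple ρ_p : Γ_K → GL₂(ℚ̄_p) unramified outside S with tr ρ_p(Frob_v) = ι⁻¹(α+β), and its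
residual semisimplification ρ̄_p (Scholze2015 Thm V.4.1/Cor. V.4.4); (ii) Jacquet–Shalika: Σ_v
|s(v)|² q_v^(−σ) ≤ log 1/(σ−1) + O(1) for π and for each conjugate π′ (DS Prop. 5.1 ↦ the simple
pole of L(s, π×π̃)); (iii) hence for every η a set of places of upper density ≤ η off which
(s(v),d(v)) lies in a finite set (DS Prop. 5.5); (iv) DS Prop. 7.2 + Chebotarev over K: |ρ̄_p(Γ_K)|
≤ A for the infinitely many p of C1 (DS Lemmas 8.3–8.4); (v) lift the prime-to-p images to
characteristic 0, compare two large p by DS Lemma 3.2 to remove ramification at p, conclude finite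
image, traces s(v), irreducibility from th -/
@[route_item "route-Langlands-BianchiDeligneSerre", crux]
def DeligneSerreTransportK : Prop :=
  ∀ (K : Type) [Field K] [NumberField K], NumberField.IsTotallyComplex K → Module.finrank ℚ K = 2 → ∀ (hcpt : Literature.NumberTheory.Automorphic.isCompact_glFiniteIntegralLevel 2 K) (π : Literature.NumberTheory.Automorphic.CuspidalAutomorphicRepData 2 K hcpt), (∃ T : Literature.NumberTheory.Automorphic.InfinityType K 2, π.1.HasInfinityType T ∧ ∀ σ : K →+* ℂ, ∀ w ∈ T σ, w.a = 0 ∧ w.b = 0) → (∃ (E : IntermediateField ℚ ℂ) (s d : IsDedekindDomain.HeightOneSpectrum (NumberField.RingOfIntegers K) → E), FiniteDimensional ℚ E ∧ (∀ᶠ v : IsDedekindDomain.HeightOneSpectrum (NumberField.RingOfIntegers K) in Filter.cofinite, IsIntegral ℤ (s v) ∧ IsIntegral ℤ (d v) ∧ ∃ α : Multiset ℂ, π.1.HasSatakeParamAt v α ∧ ((s v : E) : ℂ) = α.sum ∧ ((d v : E) : ℂ) = α.prod) ∧ ∀ τ : E →ₐ[ℚ] ℂ, ∃ π' : Literature.NumberTheory.Automorphic.CuspidalAutomorphicRepData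 2 K hcpt, (∃ T' : Literature.NumberTheory.Automorphic.InfinityType K 2, π'.1.HasInfinityType T' ∧ ∀ σ : K →+* ℂ, ∀ w ∈ T' σ, w.a = 0 ∧ w.b = 0) ∧ ∀ᶠ v : IsDedekindDomain.HeightOneSpectrum (NumberField.RingOfIntegers K) in Filter.cofinite, ∃ α' : Multiset ℂ, π'.1.HasSatakeParamAt v α' ∧ τ (s v) = α'.sum ∧ τ (d v) = α'.prod) → (∀ P₀ : ℕ, ∃ (p : ℕ) (_ : Fact p.Prime), P₀ ≤ p ∧ ∀ ι : PadicAlgCl p ≃+* ℂ, ∃ (S : Finset (IsDedekindDomain.HeightOneSpectrum (NumberField.RingOfIntegers K))) (U : Subgroup (GL (Fin 2) (IsDedekindDomain.FiniteAdeleRing (NumberField.RingOfIntegers K) K))) (ϖ : ∀ v : IsDedekindDomain.HeightOneSpectrum (NumberField.RingOfIntegers K), (v.adicCompletion K)ˣ) (a : {v : IsDedekindDomain.HeightOneSpectrum (NumberField.RingOfIntegers K) // v ∉ S} → ℕ → (Valued.v (R := PadicAlgCl p)).valuationSubring), (∀ v : IsDedekindDomain.HeightOneSpectrum (NumberField.RingOfIntegers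 K), ((p : ℕ) : NumberField.RingOfIntegers K) ∈ v.asIdeal → v ∈ S) ∧ IsOpen (U : Set (GL (Fin 2) (IsDedekindDomain.FiniteAdeleRing (NumberField.RingOfIntegers K) K))) ∧ U ≤ Literature.NumberTheory.Automorphic.glFiniteIntegralLevel 2 K ∧ (∀ g ∈ Literature.NumberTheory.Automorphic.glFiniteIntegralLevel 2 K, (∀ v ∈ S, ∀ i j : Fin 2, ((g : Matrix (Fin 2) (Fin 2) (IsDedekindDomain.FiniteAdeleRing (NumberField.RingOfIntegers K) K)) i j) v = (1 : Matrix (Fin 2) (Fin 2) (v.adicCompletion K)) i j) → g ∈ U) ∧ (∀ v : IsDedekindDomain.HeightOneSpectrum (NumberField.RingOfIntegers K), Valued.v ((ϖ v : (v.adicCompletion K)ˣ) : v.adicCompletion K) = WithZero.exp (-1 : ℤ)) ∧ Literature.NumberTheory.Automorphic.IsHeckePoint (Matrix.GeneralLinearGroup.map (n := Fin 2) (algebraMap K (IsDedekindDomain.FiniteAdeleRing (NumberField.RingOfIntegers K) K))) (Literature.NumberTheory.Automorphic.LevelTower.ofSeq U (fun r : ℕ => (Literature.NumberTheory.Automorphic.principalCongruenceLevel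 2 K (Ideal.span {((p : ℕ) : NumberField.RingOfIntegers K)} ^ r)).map (Literature.NumberTheory.Automorphic.GLn.sndHom 2 K))) ((p : ℕ) : (Valued.v (R := PadicAlgCl p)).valuationSubring) (fun j : {v : IsDedekindDomain.HeightOneSpectrum (NumberField.RingOfIntegers K) // v ∉ S} × Fin 2 => Literature.NumberTheory.Automorphic.GLn.sndHom 2 K (Literature.NumberTheory.Automorphic.heckeDiagAt 2 K j.1.1 (ϖ j.1.1) (j.2.val + 1))) (fun j => a j.1 (j.2.val + 1)) ∧ ∀ (v : IsDedekindDomain.HeightOneSpectrum (NumberField.RingOfIntegers K)) (hv : v ∉ S), ∃ α : Multiset ℂ, π.1.HasSatakeParamAt v α ∧ ι ((a ⟨v, hv⟩ 1 : (Valued.v (R := PadicAlgCl p)).valuationSubring) : PadicAlgCl p) = α.sum ∧ ((v.residueCard : ℕ) : ℂ) * ι ((a ⟨v, hv⟩ 2 : (Valued.v (R := PadicAlgCl p)).valuationSubring) : PadicAlgCl p) = α.prod) → ∀ (ℓ : ℕ) [Fact ℓ.Prime] (ι : PadicAlgCl ℓ ≃+* ℂ), ∃ ρ : Literature.NumberTheory.GaloisRepresentations.FramedGaloisRep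 K (PadicAlgCl ℓ) 2, Finite ρ.toMonoidHom.range ∧ ρ.toGaloisRep.IsIrreducible ∧ ∀ᶠ v : IsDedekindDomain.HeightOneSpectrum (NumberField.RingOfIntegers K) in Filter.cofinite, Summit.Langlands.SatakeFrobCompatibleAt ι π.1 ρ v

/-- item stmt-Langlands-15871 · crux · rank 9 · open · by planner
why it might fail: The honestly-labelled REST OF THE SUMMIT (sector (A), n=2, Artin type over imaginary quadratic K ⇒ Langlands): false exactly if GL_n reciprocity fails outside the sector; a partial claim filed as lowest-ranked crux only because closes must assume it; attack nothing here.
sources: BuzzardGeeLMS2014, FontaineMazurGeometric1995, DeligneSerre1974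
[support] JUNCTION — the honestly-labelled rest of the summit, filed only so that the deciding
theorem ends in the summit constant: (A) in the almost-everywhere Satake form with finite image for
Artin-type cuspidal π on GL₂ over imaginary quadratic fields ⇒ `Langlands`. It packages (i) the
upgrade of a finite-image a.e.-compatible ρ to the summit's `Corresponds` (de Rham = finite image;
local–global compatibility at the remaining places by stability of γ-factors and the local converse
theorem for GL₂, as in DS §4(b)), (ii) the descent K → ℚ for base-changed even Maass forms (two
auxiliary imaginary quadratic fields), and (iii) everything else in the summit (other n, other
fields, other infinity types, direction (B)). Nobody should attempt it as a whole; it is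
bookkeeping. [difficulty: open-problem] -/
@[route_item "route-Langlands-BianchiDeligneSerre", crux]
def ArtinTypeSectorToLanglands : Prop :=
  (∀ (K : Type) [Field K] [NumberField K], NumberField.IsTotallyComplex K → Module.finrank ℚ K = 2 → ∀ (hcpt : Literature.NumberTheory.Automorphic.isCompact_glFiniteIntegralLevel 2 K) (π : Literature.NumberTheory.Automorphic.CuspidalAutomorphicRepData 2 K hcpt), (∃ T : Literature.NumberTheory.Automorphic.InfinityType K 2, π.1.HasInfinityType T ∧ ∀ σ : K →+* ℂ, ∀ w ∈ T σ, w.a = 0 ∧ w.b = 0) → ∀ (ℓ : ℕ) [Fact ℓ.Prime] (ι : PadicAlgCl ℓ ≃+* ℂ), ∃ ρ : Literature.NumberTheory.GaloisRepresentations.FramedGaloisRep K (PadicAlgCl ℓ) 2, Finite ρ.toMonoidHom.range ∧ ρ.toGaloisRep.IsIrreducible ∧ ∀ᶠ v : IsDedekindDomain.HeightOneSpectrum (NumberField.RingOfIntegers K) in Filter.cofinite, Summit.Langlands.SatakeFrobCompatibleAt ι π.1 ρ v) → _root_.Langlands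

-- item stmt-Langlands-16039 · support · rank 9 · open · by planner — informal only, no Lean statement yet:
--   [support] PROPOSED ENGINE for C1 and C2 (the p–∞ switch; to become the layer-2 split of
--   PadicAutomorphyArtinTypeK / ArithmeticityArtinTypeK in tenure, not a hypothesis of closes): for K
--   imaginary quadratic of class number one, 𝔫 ⊂ 𝒪_K, and a cuspidal eigenfunction u of the Laplacian on
--   Γ₁(𝔫)∖ℍ³ with eigenvalue 1 (Artin type, s = 1), the boundary cocycle γ ↦ ψ_γ of u for the s = 1
--   principal-series action (φ|g)(z) = |cz+d|⁻² φ(gz) of PSL₂(ℂ) — note |cz+d|⁻² = ((cz+d)(c̄z̄+d̄))⁻¹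
--   is a RATIONAL function of (z, z̄), the K-analogue of the 2s ∈ ℤ accident of route
--   RationalPeriodQuarter — is cohomolog

/-- item stmt-Langlands-15872 · assembly · rank 1 · open · by planner
sources: DeligneSerre1974
[assembly] PadicAutomorphyArtinTypeK → ArithmeticityArtinTypeK → DeligneSerreTransportK →
ArtinTypeSectorToLanglands → Langlands. -/
@[route_item "route-Langlands-BianchiDeligneSerre"]
def Assembly : Prop :=
  PadicAutomorphyArtinTypeK → ArithmeticityArtinTypeK → DeligneSerreTransportK → ArtinTypeSectorToLanglands → _root_.Langlands

/-! D-0027 §2.1 — DECIDING THEOREM (planner-authored via `route open/edit --closes-file`; by planner-rbadge-Langlands-BianchiDeligneSerre-30ea037d-0 2026-08-16T16:23:15Z):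
its hypotheses are this route's items and its conclusion the sub-problem Statement (glue_lint), and it elaborates with this file. -/

@[closes "route-Langlands-BianchiDeligneSerre"] theorem closes (h₁ : PadicAutomorphyArtinTypeK) (h₂ : ArithmeticityArtinTypeK)
    (h₃ : DeligneSerreTransportK) (h₄ : ArtinTypeSectorToLanglands) : _root_.Langlands :=
  h₄ (fun K _ _ hK hK2 hcpt π hπ => h₃ K hK hK2 hcpt π hπ (h₂ K hK hK2 hcpt π hπ) (h₁ K hK hK2 hcpt π hπ))

end Summit.Langlands.Langlands.Theses.BianchiDeligneSerre
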